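import Summits.KontsevichZagierPeriods.KontsevichZagierPeriods.Theorems.HurwitzMicroSectorsNormalFormPrincipleQuadLog
import Summits.KontsevichZagierPeriods.KontsevichZagierPeriods.Theorems.AbelContractionRealHyperellipticSectorPortSiegeNfAPoleOneK3

/-!
# Route AbelContraction — `RealHyperellipticSector` (crux stmt-KontsevichZagierPeriods-12475):
# the dimension-certified port, layer 3 — the logarithmic and arctangent parts of a quadratic pole

Helper file of the line `Lines/birth.lean` (stub `stub_bakerAlg`, `--supports` the crux): the port
of `Theorems/HurwitzMicroSectorsNormalFormPrincipleQuadLog.lean` (namespace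
`…NormalFormPrinciple.PiBox.Dlog`) INTO THE BUDGET `KZ.relationsLE 1`: the three substitution
moves for a simple quadratic pole `(A(x−u) + c)/((x−u)²+v²)` (`v > 0`, real algebraic data), each
ONE rule-(2) move among representations of dimension `1` (plus a congruence):

* `quad_log_right_sub_mem_relationsLE` (registered sub-goal) — `y = (x−u)² + v²` to the right of
  `u` (non-linear, via the route constructor `stub_pushforwardDimOne`, whose certificate
  `[N] − [s] ∈ changeOfVariablesRel` between two representations of dimension `1` is a truncated
  relation by `KZ.of_mem_formalRepLE`);
* `quad_log_left_sub_mem_relationsLE` — to the left of `u` (reflect `x ↦ −x` first);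
* `quad_ang_sub_mem_relationsLE` — the affine substitution `y = (x−u)/v` for the arctangent part.

The affine move is `Port.Dlog.SiegeK3.affineA_sub_mem_relationsLE`; the dimension-free lemmas
(`exists_quadRep`, `quad_pos`, `isSemialgebraicFunOn_quad`, `image_affine_slab_of_pos/neg`,
`AlgSplitK5.isSemialgebraicFunOn_aevalK`) are reused from the originals.

Sources: M. Kontsevich, D. Zagier, *Periods* (2001), §1.2 rule (2) [KontsevichZagier2001].
No definitions are introduced.
-/

noncomputable section

open MeasureTheory Set
open scoped Polynomial
open Literature.NumberTheory.Transcendental Literature.NumberTheory.Transcendental.KZ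
open Literature.ModelTheory.ExponentialFields (IsSemialgebraic)

namespace Summit.KontsevichZagierPeriods.AbelContraction.RealHyperellipticSector.Port

namespace Dlog

open Summit.KontsevichZagierPeriods.HermiteRigidity.GenusTwoCycleTransfer (stub_pushforwardDimOne)
open Summit.KontsevichZagierPeriods.HurwitzMicroSectors.NormalFormPrinciple.PiBox
  (AlgSplitK5.isSemialgebraicFunOn_aevalK)
open Summit.KontsevichZagierPeriods.HurwitzMicroSectors.NormalFormPrinciple.PiBox.Dlog
  (isSemialgebraic_setOf_apply_mem_Ioo_of_isAlgebraic quad_pos isSemialgebraicFunOn_quad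
    exists_quadRep image_affine_slab_of_pos image_affine_slab_of_neg)

/-! ## The logarithmic part of a simple quadratic pole inside the budget -/

/-- **Change of variables `y = (x−u)² + v²` to the right of `u`** (rule 2 among representations of
dimension `1`, non-linear, via the route constructor `stub_pushforwardDimOne`) (inside the budget
`relationsLE 1`; registered sub-goal of crux stmt-KontsevichZagierPeriods-12475, port of
`PiBox.Dlog.quad_log_right_sub_mem_relations`): for algebraic `u ≤ a ≤ b`, `v > 0`,
`[(a,b), A(x−u)/((x−u)²+v²)] − [((a−u)²+v², (b−u)²+v²), (A/2)/y] ∈ relationsLE 1`.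
[cite: KontsevichZagier2001, §1.2 rule (2)] -/
theorem quad_log_right_sub_mem_relationsLE : ∀ {a b A u v : ℝ}, IsAlgebraic ℚ a →
    IsAlgebraic ℚ b → IsAlgebraic ℚ u → IsAlgebraic ℚ v → 0 < v → u ≤ a → a ≤ b →
    ∀ (N L : KZ.IntegralRep 1), N.domain = {x | x 0 ∈ Set.Ioo a b} →
    Set.EqOn N.integrand (fun x => A * (x 0 - u) / ((x 0 - u) ^ 2 + v ^ 2)) N.domain →
    L.domain = {x | x 0 ∈ Set.Ioo ((a - u) ^ 2 + v ^ 2) ((b - u) ^ 2 + v ^ 2)} →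
    Set.EqOn L.integrand (fun x => (A / 2) / x 0) L.domain →
    KZ.of N - KZ.of L ∈ KZ.relationsLE 1 := by
  intro a b A u v ha hb hu hv hv0 hua hab N L hNd hNi hLd hLi
  set φ : ℝ → ℝ := fun y => (y - u) ^ 2 + v ^ 2 with hφ
  set φ' : ℝ → ℝ := fun y => 2 * (y - u) with hφ'
  set G : (Fin 1 → ℝ) → (Fin 1 → ℝ) := fun w => fun _ => u + Real.sqrt (w 0 - v ^ 2) with hG
  set uK : algebraicClosure ℚ ℝ := ⟨u, mem_algebraicClosure_iff.mpr hu⟩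
  set vK : algebraicClosure ℚ ℝ := ⟨v, mem_algebraicClosure_iff.mpr hv⟩
  have hdomsa : IsSemialgebraic ℚ N.domain := N.isSemialgebraic_domain
  have hposI : ∀ p ∈ N.domain, 0 < p 0 - u := by
    intro p hp; rw [hNd] at hp; linarith [hp.1]
  -- semialgebraicity of `φ`, `φ'`
  have hφsa : IsSemialgebraicFunOn ℚ N.domain (fun p => φ (p 0)) := by
    refine (AlgSplitK5.isSemialgebraicFunOn_aevalK hdomsa ((Polynomial.X - Polynomial.C uK) ^ 2 +
      Polynomial.C (vK ^ 2))).congr fun x _ => ?_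
    show (Polynomial.aeval (x 0) ((Polynomial.X - Polynomial.C uK) ^ 2 + Polynomial.C (vK ^ 2) :
      (algebraicClosure ℚ ℝ)[X]) : ℝ) = (x 0 - u) ^ 2 + v ^ 2
    simp only [map_add, map_pow, map_sub, Polynomial.aeval_X, Polynomial.aeval_C]
    rfl
  have hφ'sa : IsSemialgebraicFunOn ℚ N.domain (fun p => φ' (p 0)) := by
    refine (isSemialgebraicFunOn_quad hdomsa (isAlgebraic_nat (R := ℚ) 2) isAlgebraic_zero hu hv
      hv0.ne' 0).congr fun x _ => ?_
    show ((2:ℕ) * (x 0 - u) + 0) / ((x 0 - u) ^ 2 + v ^ 2) ^ 0 = 2 * (x 0 - u)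
    rw [pow_zero, div_one, add_zero, Nat.cast_ofNat]
  have hder : ∀ p ∈ N.domain, HasDerivAt φ (φ' (p 0)) (p 0) := by
    intro p _
    refine ((((hasDerivAt_id' (p 0)).sub_const u).pow 2).add_const (v ^ 2)).congr_deriv ?_
    show ((2:ℕ):ℝ) * (p 0 - u) ^ (2 - 1) * 1 = 2 * (p 0 - u)
    norm_num
  have hne : ∀ p ∈ N.domain, φ' (p 0) ≠ 0 := by
    intro p hp; simp only [hφ']; linarith [hposI p hp]
  -- the image and the inverse
  have himg : (fun p : Fin 1 → ℝ => fun _ : Fin 1 => φ (p 0)) '' N.domain =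
      {x | x 0 ∈ Set.Ioo ((a - u) ^ 2 + v ^ 2) ((b - u) ^ 2 + v ^ 2)} := by
    rw [hNd]
    ext w
    simp only [Set.mem_image, Set.mem_setOf_eq, Set.mem_Ioo]
    constructor
    · rintro ⟨p, ⟨h1, h2⟩, rfl⟩
      show (a - u) ^ 2 + v ^ 2 < (p 0 - u) ^ 2 + v ^ 2 ∧ (p 0 - u) ^ 2 + v ^ 2 < (b - u) ^ 2 + v ^ 2
      constructor <;> nlinarith
    · rintro ⟨h1, h2⟩
      have hw0 : 0 ≤ w 0 - v ^ 2 := by nlinarith [sq_nonneg (a - u)]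
      have hsq : Real.sqrt (w 0 - v ^ 2) ^ 2 = w 0 - v ^ 2 := Real.sq_sqrt hw0
      have hya : a - u < Real.sqrt (w 0 - v ^ 2) := (Real.lt_sqrt (by linarith)).mpr (by linarith)
      have hbu : 0 < b - u := by nlinarith [sq_nonneg (a - u)]
      have hyb : Real.sqrt (w 0 - v ^ 2) < b - u := (Real.sqrt_lt' hbu).mpr (by linarith)
      refine ⟨fun _ => u + Real.sqrt (w 0 - v ^ 2), ⟨by linarith, by linarith⟩, ?_⟩
      funext i
      show (u + Real.sqrt (w 0 - v ^ 2) - u) ^ 2 + v ^ 2 = w i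
      rw [Fin.fin_one_eq_zero i, add_sub_cancel_left, hsq]
      ring
  have hGφ : ∀ p ∈ N.domain, G (fun _ => φ (p 0)) = p := by
    intro p hp
    funext i
    rw [Fin.fin_one_eq_zero i]
    show u + Real.sqrt ((p 0 - u) ^ 2 + v ^ 2 - v ^ 2) = p 0
    rw [add_sub_cancel_right, Real.sqrt_sq (hposI p hp).le]
    ring
  have himgsa : IsSemialgebraic ℚ ((fun p : Fin 1 → ℝ => fun _ : Fin 1 => φ (p 0)) '' N.domain) := by
    rw [himg]
    exact isSemialgebraic_setOf_apply_mem_Ioo_of_isAlgebraic (((ha.sub hu).pow 2).add (hv.pow 2))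
      (((hb.sub hu).pow 2).add (hv.pow 2)) 0
  have hG : IsSemialgebraicMapOn ℚ ((fun p : Fin 1 → ℝ => fun _ : Fin 1 => φ (p 0)) '' N.domain)
      G := by
    refine IsSemialgebraicMapOn.of_forall himgsa fun j => ?_
    have hlin : IsSemialgebraicFunOn ℚ ((fun p : Fin 1 → ℝ => fun _ : Fin 1 => φ (p 0)) '' N.domain)
        (fun w => w 0 - v ^ 2) := by
      refine (AlgSplitK5.isSemialgebraicFunOn_aevalK himgsa
        (Polynomial.X - Polynomial.C (vK ^ 2))).congr fun x _ => ?_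
      show (Polynomial.aeval (x 0) (Polynomial.X - Polynomial.C (vK ^ 2) :
        (algebraicClosure ℚ ℝ)[X]) : ℝ) = x 0 - v ^ 2
      simp only [map_sub, map_pow, Polynomial.aeval_X, Polynomial.aeval_C]
      rfl
    exact IsSemialgebraicFunOn.add_holds (isSemialgebraicFunOn_const_of_isAlgebraic himgsa hu)
      (IsSemialgebraicFunOn.sqrt_holds hlin)
  -- push forward (ONE change of variables between representations of dimension `1`)
  obtain ⟨s, hsd, hsi, hmove⟩ := stub_pushforwardDimOne N φ φ' G hφsa hφ'sa hder hne hG hGφ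
  have h1 : of N - of s ∈ relationsLE 1 :=
    movesLE_subset_relationsLE 1
      ⟨Or.inl (Or.inr hmove), sub_mem (of_mem_formalRepLE N le_rfl) (of_mem_formalRepLE s le_rfl)⟩
  -- and compare with `L`
  have h2 : of s - of L ∈ relationsLE 1 := by
    refine Budget.congr_mem_relationsLE le_rfl (by rw [hLd, hsd, himg]) ?_
    intro z hz
    rw [hsd] at hz
    obtain ⟨p, hp, rfl⟩ := hz
    rw [hsi p hp, hNi hp, hLi (by rw [hLd, ← himg]; exact Set.mem_image_of_mem _ hp)]
    have h0 := hposI p hp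
    show A * (p 0 - u) / ((p 0 - u) ^ 2 + v ^ 2) / |2 * (p 0 - u)| =
      (A / 2) / ((p 0 - u) ^ 2 + v ^ 2)
    rw [abs_of_pos (by linarith)]
    have hQ := (quad_pos (u := u) hv0.ne' (p 0)).ne'
    rw [div_div, div_eq_div_iff (mul_ne_zero hQ (by linarith)) hQ]
    ring
  have : of N - of L = (of N - of s) + (of s - of L) := by abel
  rw [this]
  exact (relationsLE 1).add_mem h1 h2

/-- **The logarithmic part to the left of `u`** (inside the budget `relationsLE 1`): for algebraic
`a ≤ b ≤ u`, `v > 0`, `[(a,b), A(x−u)/((x−u)²+v²)] − [((b−u)²+v², (a−u)²+v²), (−A/2)/y]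
∈ relationsLE 1` (reflect `x ↦ −x`, one rule-(2) move in dimension `1`, then
`quad_log_right_sub_mem_relationsLE`). [cite: KontsevichZagier2001, §1.2 rule (2)] -/
theorem quad_log_left_sub_mem_relationsLE {a b A u v : ℝ} (ha : IsAlgebraic ℚ a)
    (hb : IsAlgebraic ℚ b) (hA : IsAlgebraic ℚ A) (hu : IsAlgebraic ℚ u) (hv : IsAlgebraic ℚ v)
    (hv0 : 0 < v) (hbu : b ≤ u) (hab : a ≤ b) (N L : IntegralRep 1)
    (hNd : N.domain = {x | x 0 ∈ Set.Ioo a b})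
    (hNi : EqOn N.integrand (fun x => A * (x 0 - u) / ((x 0 - u) ^ 2 + v ^ 2)) N.domain)
    (hLd : L.domain = {x | x 0 ∈ Set.Ioo ((b - u) ^ 2 + v ^ 2) ((a - u) ^ 2 + v ^ 2)})
    (hLi : EqOn L.integrand (fun x => (-A / 2) / x 0) L.domain) : of N - of L ∈ relationsLE 1 := by
  -- the reflected representation
  obtain ⟨N', hN'd, hN'i⟩ := exists_quadRep (a := -b) (b := -a) (A := -A) (B := 0) (u := -u)
    hb.neg ha.neg hA.neg isAlgebraic_zero hu.neg hv hv0.ne' 1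
  have hN'i' : EqOn N'.integrand (fun x => -A * (x 0 - -u) / ((x 0 - -u) ^ 2 + v ^ 2)) N'.domain := by
    intro x _; rw [hN'i]; simp only [add_zero, pow_one]
  have h1 : of N - of N' ∈ relationsLE 1 := by
    refine SiegeK3.affineA_sub_mem_relationsLE (s := -1) (t := 0) isAlgebraic_one.neg
      isAlgebraic_zero (by norm_num) N N' (fun y => -A * (y - -u) / ((y - -u) ^ 2 + v ^ 2)) ?_ hN'i'
      fun x hx => ?_
    · rw [hN'd, hNd, image_affine_slab_of_neg (by norm_num : (-1:ℝ) < 0)]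
      simp only [neg_one_mul, add_zero]
    · rw [hNi hx]
      have hQ := (quad_pos (u := u) hv0.ne' (x 0)).ne'
      have hQ' : (-1 * x 0 + 0 - -u) ^ 2 + v ^ 2 ≠ 0 := (quad_pos (u := -u) hv0.ne' _).ne'
      show A * (x 0 - u) / ((x 0 - u) ^ 2 + v ^ 2) =
        -A * (-1 * x 0 + 0 - -u) / ((-1 * x 0 + 0 - -u) ^ 2 + v ^ 2) * |(-1:ℝ)|
      rw [abs_neg, abs_one, mul_one, div_eq_div_iff hQ hQ']
      ring
  have h2 : of N' - of L ∈ relationsLE 1 := by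
    refine quad_log_right_sub_mem_relationsLE hb.neg ha.neg hu.neg hv hv0 (by linarith) (by linarith)
      N' L hN'd hN'i' ?_ hLi
    rw [show (-b - -u) ^ 2 + v ^ 2 = (b - u) ^ 2 + v ^ 2 by ring,
      show (-a - -u) ^ 2 + v ^ 2 = (a - u) ^ 2 + v ^ 2 by ring]
    exact hLd
  have : of N - of L = (of N - of N') + (of N' - of L) := by abel
  rw [this]
  exact (relationsLE 1).add_mem h1 h2

/-! ## The arctangent part of a simple quadratic pole inside the budget -/

/-- **The affine substitution `y = (x−u)/v`** (rule 2 among representations of dimension `1`)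
(inside the budget `relationsLE 1`): for algebraic `u`, `v > 0`,
`[(a,b), c/((x−u)²+v²)] − [((a−u)/v, (b−u)/v), (c/v)/(1+y²)] ∈ relationsLE 1`.
[cite: KontsevichZagier2001, §1.2 rule (2)] -/
theorem quad_ang_sub_mem_relationsLE {a b c u v : ℝ} (hu : IsAlgebraic ℚ u) (hv : IsAlgebraic ℚ v)
    (hv0 : 0 < v) (N L : IntegralRep 1) (hNd : N.domain = {x | x 0 ∈ Set.Ioo a b})
    (hNi : EqOn N.integrand (fun x => c / ((x 0 - u) ^ 2 + v ^ 2)) N.domain)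
    (hLd : L.domain = {x | x 0 ∈ Set.Ioo ((a - u) / v) ((b - u) / v)})
    (hLi : EqOn L.integrand (fun x => (c / v) / (1 + x 0 ^ 2)) L.domain) :
    of N - of L ∈ relationsLE 1 := by
  have hv0' : v ≠ 0 := hv0.ne'
  have htA : IsAlgebraic ℚ (-u / v) := by rw [div_eq_mul_inv]; exact hu.neg.mul hv.inv
  refine SiegeK3.affineA_sub_mem_relationsLE (s := v⁻¹) (t := -u / v) hv.inv htA (inv_ne_zero hv0')
    N L (fun y => (c / v) / (1 + y ^ 2)) ?_ hLi fun x hx => ?_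
  · rw [hLd, hNd, image_affine_slab_of_pos (inv_pos.mpr hv0)]
    rw [show v⁻¹ * a + -u / v = (a - u) / v by
        rw [inv_mul_eq_div, neg_div, ← sub_eq_add_neg, sub_div],
      show v⁻¹ * b + -u / v = (b - u) / v by
        rw [inv_mul_eq_div, neg_div, ← sub_eq_add_neg, sub_div]]
  · rw [hNi hx]
    have hQ := (quad_pos (u := u) hv0' (x 0)).ne'
    show c / ((x 0 - u) ^ 2 + v ^ 2) = (c / v) / (1 + (v⁻¹ * x 0 + -u / v) ^ 2) * |v⁻¹|
    rw [abs_of_pos (inv_pos.mpr hv0),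
      show v⁻¹ * x 0 + -u / v = (x 0 - u) / v by
        rw [inv_mul_eq_div, neg_div, ← sub_eq_add_neg, sub_div],
      div_pow, one_add_div (pow_ne_zero 2 hv0'), div_div_eq_mul_div, div_eq_iff hQ]
    field_simp
    ring

end Dlog

end Summit.KontsevichZagierPeriods.AbelContraction.RealHyperellipticSector.Port

end
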